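import Mathlib.Tactic.Linarith
import Mathlib.Tactic.Ring
import Mathlib.Tactic.Positivity
import Mathlib.Tactic.Zify
import Mathlib.Tactic.LinearCombination
import Mathlib.Algebra.Group.Int.Even
import Summits.MatrixMultiplication.OmegaCensus.DihedralLawShape
import Summits.MatrixMultiplication.OmegaCensus.DihedralLawAttainedCyclic
import Summits.MatrixMultiplication.OmegaCensus.C2DihedralLawGap
import HarnessLib

/-!
# No TPP triple has volume `4⌊2|A|/3⌋ − 1` (`|A| ≡ 2 (mod 3)`); non-cyclic `A` misses the law by at least `2`

ω-census, family (b3).  Framing: lottery ticket; floor = certified bounds/negative ranges.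

For a dihedral-like group over `A` (`|A| = N ≡ 2 (mod 3)`, `N` even, `N ≥ 14`; any `c₀`) the value
`3V = 8N − 7` (one below the law `3V = 8N − 4`) is impossible (`tpp_volume_ne_law_sub_one`): the A-level
classification leaves the classes `(A₁,A₂) = (N,N)` (excluded by `three_dvd_of_double_tiling'`) and `(N, N−1)` with
`(3A₀,3A₃) ∈ {(N+1,N−5), (N−2,N−2)}` (or mirrored), and both die at the level of the three parts `x, y, z` of the
tiling triangle (Vieta): in the first, `(x−q−1)²(x−q) = −(q+1)²` is odd = even; in the second, `μ = x − q` satisfies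
`(2q+3μ)² = μ²(4μ+1)`, forcing `μ = j²+j`, `q = j³−j`, and then the other two parts would have negative squared
difference.  Consequently (`tpp_volume_le_law_sub_two_of_not_cyclic`) over a non-cyclic `A` every TPP triple has
`3|S||T||U| + 10 ≤ 8|A|`, i.e. `|S||T||U| ≤ 4⌊2|A|/3⌋ − 2`.
-/

namespace Summit.MatrixMultiplication.OmegaCensus

open Literature.Combinatorics.Additive Finset

/-- Class `(3A₀, 3A₃) = (N+1, N−5)`: a part `x` of the tiling triangle would satisfy
`(x−q−1)²(x−q) = −(q+1)²` with `q` even — parity contradiction. [folklore] -/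
theorem no_root_class_a {x y z q : ℤ} (hq : q % 2 = 0) (h1 : x + y + z = 3 * q + 2)
    (h2 : x * y + y * z + z * x = (q + 1) * (3 * q + 1)) (h3 : x * y * z = (q + 1) ^ 2 * (q - 1)) : False := by
  have h := vieta_root x y z
  rw [h1, h2, h3] at h
  have key : (x - q - 1) ^ 2 * (x - q - 1 + 1) = -(q + 1) ^ 2 := by linear_combination h
  have hodd : Odd (-(q + 1) ^ 2) := Odd.neg (Odd.pow (⟨q / 2, by omega⟩ : Odd (q + 1)))
  have heven : Even ((x - q - 1) ^ 2 * (x - q - 1 + 1)) := by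
    rcases Int.even_or_odd (x - q - 1) with hm | hm
    · have hm' : Even (x - q - 1) := hm
      exact Even.mul_right (Even.pow_of_ne_zero hm' two_ne_zero) _
    · have hm' : Odd (x - q - 1) := hm
      exact Even.mul_left (Int.even_add_one.2 (Int.not_even_iff_odd.2 hm')) _
  rw [key] at heven
  exact (Int.not_even_iff_odd.2 hodd) heven

/-- Class `(3A₀, 3A₃) = (N−2, N−2)`: with `μᵢ = xᵢ − q` one has `Σμ = 2`, `Σμᵢμⱼ = −3q`, and each `μ` is a root
of `μ³ − 2μ² − 3qμ − q²`; then `μ = j² + j`, `q = j³ − j` (`j ≥ 2`) and `(μ₂ − μ₃)² < 0`. [folklore] -/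
theorem no_root_class_b {x y z q : ℤ} (hq1 : 1 ≤ q) (h1 : x + y + z = 3 * q + 2)
    (h2 : x * y + y * z + z * x = q * (3 * q + 1)) (h3 : x * y * z = q ^ 3) : False := by
  have h := vieta_root x y z
  rw [h1, h2, h3] at h
  -- `μ = x - q`
  have g : (x - q) ^ 3 - 2 * (x - q) ^ 2 - 3 * q * (x - q) - q ^ 2 = 0 := by linear_combination h
  have hsq : (2 * q + 3 * (x - q)) ^ 2 = (x - q) ^ 2 * (4 * (x - q) + 1) := by linear_combination (-4 : ℤ) * g
  have hμ0 : x - q ≠ 0 := by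
    intro h0
    rw [h0] at g
    have : q ^ 2 = 0 := by linear_combination -g
    have := pow_eq_zero_iff (n := 2) (by norm_num) |>.1 this
    omega
  -- `μ ∣ 2q + 3μ`
  have hdvd : (x - q) ∣ 2 * q + 3 * (x - q) := by
    have : (x - q) ^ 2 ∣ (2 * q + 3 * (x - q)) ^ 2 := ⟨4 * (x - q) + 1, hsq⟩
    exact (Int.pow_dvd_pow_iff two_ne_zero).1 this
  obtain ⟨k, hk⟩ := hdvd
  have hk2 : 4 * (x - q) + 1 = k ^ 2 := by
    have e : (x - q) ^ 2 * (4 * (x - q) + 1) = (x - q) ^ 2 * k ^ 2 := by rw [← hsq, hk]; ring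
    exact mul_left_cancel₀ (pow_ne_zero 2 hμ0) e
  -- `k` is odd, `k = 2j + 1`, `μ = j² + j`
  obtain ⟨j, hj⟩ : ∃ j, k = 2 * j + 1 := by
    rcases Int.even_or_odd k with ⟨j, hj⟩ | ⟨j, hj⟩
    · exfalso
      have : k ^ 2 = 4 * (j * j) := by rw [hj]; ring
      omega
    · exact ⟨j, hj⟩
  have hμ : x - q = j ^ 2 + j := by
    have : k ^ 2 = 4 * (j ^ 2 + j) + 1 := by rw [hj]; ring
    linarith
  have hqj : q = j ^ 3 - j := by
    have e : 2 * q + 3 * (x - q) = (x - q) * k := hk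
    rw [hμ, hj] at e
    have e2 : 2 * q = 2 * (j ^ 3 - j) := by linear_combination e
    linarith
  -- `j ≥ 2`
  have hj2 : 2 ≤ j := by
    by_contra hc
    push Not at hc
    have hjj : 0 ≤ j * (j + 1) := by
      rcases le_or_gt 0 j with h0 | h0
      · exact mul_nonneg h0 (by linarith)
      · exact mul_nonneg_of_nonpos_of_nonpos h0.le (by omega)
    have : q ≤ 0 := by
      rw [hqj, show j ^ 3 - j = (j - 1) * (j * (j + 1)) by ring]
      exact mul_nonpos_of_nonpos_of_nonneg (by omega) hjj
    omega
  -- the other two parts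
  have hs : (y - q) + (z - q) = 2 - (x - q) := by linarith
  have hp : (x - q) * (y - q) + (x - q) * (z - q) + (y - q) * (z - q) = -3 * q := by
    linear_combination h2 - 2 * q * h1
  have e : (y - q) * (z - q) = -3 * q - (x - q) * ((y - q) + (z - q)) := by linear_combination hp
  rw [hs] at e
  have hD : ((y - q) - (z - q)) ^ 2 = ((y - q) + (z - q)) ^ 2 - 4 * ((y - q) * (z - q)) := by ring
  rw [hs, e, hμ, hqj] at hD
  have hP : 0 ≤ (j - 2) * (3 * j ^ 3 - j + 6) :=
    mul_nonneg (by linarith) (by nlinarith [hj2])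
  nlinarith [sq_nonneg ((y - q) - (z - q)), hD, hP]

/-- The triangle sums and `(3A₀, 3A₃)` one below the law (`3V + 7 = 8N`, `N ≡ 2 (mod 3)`): both sums `N`, or
`(N, N−1)` with `(3A₀,3A₃) ∈ {(N+1,N−5), (N−2,N−2)}`, or the mirror image. [folklore] -/
theorem law_sub_one_classes (N A₀ B₁ B₂ A₃ : ℤ) (hN : 14 ≤ N) (hmod : N % 3 = 2)
    (hN₁ : 3 * A₀ * B₂ ≤ B₁ ^ 2) (hN₂ : 3 * B₁ * A₃ ≤ B₂ ^ 2)
    (q₁ : B₁ ≤ N) (q₂ : B₂ ≤ N) (hA1 : N - 2 ≤ B₁) (hA2 : N - 2 ≤ B₂) (hsum : 2 * N - 2 ≤ B₁ + B₂)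
    (eV : 3 * (A₀ + B₁ + B₂ + A₃) + 7 = 8 * N) :
    (B₁ = N ∧ B₂ = N) ∨
    (B₁ = N ∧ B₂ = N - 1 ∧ ((3 * A₀ = N + 1 ∧ 3 * A₃ = N - 5) ∨ (3 * A₀ = N - 2 ∧ 3 * A₃ = N - 2))) ∨
    (B₁ = N - 1 ∧ B₂ = N ∧ ((3 * A₃ = N + 1 ∧ 3 * A₀ = N - 5) ∨ (3 * A₃ = N - 2 ∧ 3 * A₀ = N - 2))) := by
  have hB1 : B₁ = N - 2 ∨ B₁ = N - 1 ∨ B₁ = N := by omega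
  have hB2 : B₂ = N - 2 ∨ B₂ = N - 1 ∨ B₂ = N := by omega
  rcases hB1 with b1 | b1 | b1 <;> rcases hB2 with b2 | b2 | b2
  · exfalso; linarith only [b1, b2, hsum]
  · exfalso; linarith only [b1, b2, hsum]
  · exfalso
    rw [b1, b2] at hN₁ hN₂
    have u0 : 3 * A₀ ≤ N - 4 := by
      by_contra hc
      have hc' : N - 3 ≤ 3 * A₀ := by omega
      linarith only [mul_le_mul_of_nonneg_right hc' (by linarith only [hN] : (0:ℤ) ≤ N), hN₁, hN]
    have u3 : 3 * A₃ ≤ N + 2 := by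
      by_contra hc
      have hc' : N + 3 ≤ 3 * A₃ := by omega
      linarith only [mul_le_mul_of_nonneg_left hc' (by linarith only [hN] : (0:ℤ) ≤ N - 2), hN₂, hN]
    linarith only [u0, u3, eV, b1, b2]
  · exfalso; linarith only [b1, b2, hsum]
  · exfalso
    rw [b1, b2] at hN₁ hN₂
    have u0 : 3 * A₀ ≤ N - 1 := by
      by_contra hc
      have hc' : N ≤ 3 * A₀ := by omega
      linarith only [mul_le_mul_of_nonneg_right hc' (by linarith only [hN] : (0:ℤ) ≤ N - 1), hN₁, hN]
    have u3 : 3 * A₃ ≤ N - 1 := by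
      by_contra hc
      have hc' : N ≤ 3 * A₃ := by omega
      linarith only [mul_le_mul_of_nonneg_left hc' (by linarith only [hN] : (0:ℤ) ≤ N - 1), hN₂, hN]
    linarith only [u0, u3, eV, b1, b2]
  · right; right
    rw [b1, b2] at hN₁ hN₂
    have u0 : 3 * A₀ ≤ N - 2 := by
      by_contra hc
      have hc' : N - 1 ≤ 3 * A₀ := by omega
      linarith only [mul_le_mul_of_nonneg_right hc' (by linarith only [hN] : (0:ℤ) ≤ N), hN₁, hN]
    have u3 : 3 * A₃ ≤ N + 1 := by
      by_contra hc
      have hc' : N + 2 ≤ 3 * A₃ := by omega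
      linarith only [mul_le_mul_of_nonneg_left hc' (by linarith only [hN] : (0:ℤ) ≤ N - 1), hN₂, hN]
    refine ⟨b1, b2, ?_⟩
    omega
  · exfalso
    rw [b1, b2] at hN₁ hN₂
    have u0 : 3 * A₀ ≤ N + 2 := by
      by_contra hc
      have hc' : N + 3 ≤ 3 * A₀ := by omega
      linarith only [mul_le_mul_of_nonneg_right hc' (by linarith only [hN] : (0:ℤ) ≤ N - 2), hN₁, hN]
    have u3 : 3 * A₃ ≤ N - 4 := by
      by_contra hc
      have hc' : N - 3 ≤ 3 * A₃ := by omega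
      linarith only [mul_le_mul_of_nonneg_left hc' (by linarith only [hN] : (0:ℤ) ≤ N), hN₂, hN]
    linarith only [u0, u3, eV, b1, b2]
  · right; left
    rw [b1, b2] at hN₁ hN₂
    have u0 : 3 * A₀ ≤ N + 1 := by
      by_contra hc
      have hc' : N + 2 ≤ 3 * A₀ := by omega
      linarith only [mul_le_mul_of_nonneg_right hc' (by linarith only [hN] : (0:ℤ) ≤ N - 1), hN₁, hN]
    have u3 : 3 * A₃ ≤ N - 2 := by
      by_contra hc
      have hc' : N - 1 ≤ 3 * A₃ := by omega
      linarith only [mul_le_mul_of_nonneg_left hc' (by linarith only [hN] : (0:ℤ) ≤ N), hN₂, hN]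
    refine ⟨b1, b2, ?_⟩
    omega
  · left; exact ⟨b1, b2⟩

/-- **Parts level: `3V + 7 = 8N` forces both triangles to tile** (and all parts non-empty). [folklore] -/
theorem parts_no_law_sub_one (N s₀ s₁ t₀ t₁ u₀ u₁ : ℕ) (hmod : N % 3 = 2) (heven : N % 2 = 0) (hN : 14 ≤ N)
    (h₀ : s₀ * t₀ * u₀ ≤ N) (h₃ : s₁ * t₁ * u₁ ≤ N)
    (h₁ : s₁ * t₀ * u₀ + s₀ * t₁ * u₀ + s₀ * t₀ * u₁ ≤ N)
    (h₂ : s₀ * t₁ * u₁ + s₁ * t₀ * u₁ + s₁ * t₁ * u₀ ≤ N)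
    (hV : 3 * ((s₀ + s₁) * (t₀ + t₁) * (u₀ + u₁)) + 7 = 8 * N) :
    1 ≤ s₀ * t₀ * u₀ ∧ 1 ≤ s₁ * t₁ * u₁ ∧ s₁ * t₀ * u₀ + s₀ * t₁ * u₀ + s₀ * t₀ * u₁ = N ∧
      s₀ * t₁ * u₁ + s₁ * t₀ * u₁ + s₁ * t₁ * u₀ = N := by
  obtain ⟨hA0, hA3, hA1, hA2, hsum, -, -⟩ :=
    parts_mod_two N s₀ s₁ t₀ t₁ u₀ u₁ hmod heven hN h₀ h₃ h₁ h₂ (by omega)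
  set A₀ : ℤ := (s₀ : ℤ) * t₀ * u₀ with hA₀
  set A₃ : ℤ := (s₁ : ℤ) * t₁ * u₁ with hA₃
  set X : ℤ := (s₁ : ℤ) * t₀ * u₀ with hX
  set Y : ℤ := (s₀ : ℤ) * t₁ * u₀ with hY
  set Z : ℤ := (s₀ : ℤ) * t₀ * u₁ with hZ
  set X' : ℤ := (s₀ : ℤ) * t₁ * u₁ with hX'
  set Y' : ℤ := (s₁ : ℤ) * t₀ * u₁ with hY'
  set Z' : ℤ := (s₁ : ℤ) * t₁ * u₀ with hZ'
  have e₁ : A₀ * (X' + Y' + Z') = X * Y + Y * Z + Z * X := by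
    simp only [hA₀, hX, hY, hZ, hX', hY', hZ']; ring
  have e₂ : (X + Y + Z) * A₃ = X' * Y' + Y' * Z' + Z' * X' := by
    simp only [hA₃, hX, hY, hZ, hX', hY', hZ']; ring
  have e₃ : X * Y * Z = A₀ ^ 2 * A₃ := by
    simp only [hA₀, hA₃, hX, hY, hZ]; ring
  have e₃' : X' * Y' * Z' = A₃ ^ 2 * A₀ := by
    simp only [hA₀, hA₃, hX', hY', hZ']; ring
  have hN₁ : 3 * A₀ * (X' + Y' + Z') ≤ (X + Y + Z) ^ 2 := by
    linarith [e₁, sq_nonneg (X - Y), sq_nonneg (Y - Z), sq_nonneg (Z - X)]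
  have hN₂ : 3 * (X + Y + Z) * A₃ ≤ (X' + Y' + Z') ^ 2 := by
    linarith [e₂, sq_nonneg (X' - Y'), sq_nonneg (Y' - Z'), sq_nonneg (Z' - X')]
  have eV : 3 * (A₀ + (X + Y + Z) + (X' + Y' + Z') + A₃) + 7 = 8 * (N : ℤ) := by
    have : ((3 * ((s₀ + s₁) * (t₀ + t₁) * (u₀ + u₁)) + 7 : ℕ) : ℤ) = 8 * (N : ℤ) := by exact_mod_cast hV
    rw [← this]; simp only [hA₀, hA₃, hX, hY, hZ, hX', hY', hZ']; push_cast; ring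
  have qA1 : (N : ℤ) - 2 ≤ X + Y + Z := by zify at hA1; linarith
  have qA2 : (N : ℤ) - 2 ≤ X' + Y' + Z' := by zify at hA2; linarith
  have q₁ : X + Y + Z ≤ N := by zify at h₁; linarith
  have q₂ : X' + Y' + Z' ≤ N := by zify at h₂; linarith
  have qsum : 2 * (N : ℤ) - 2 ≤ (X + Y + Z) + (X' + Y' + Z') := by zify at hsum; linarith
  have hNpos : (14 : ℤ) ≤ N := by exact_mod_cast hN
  have hmodz : (N : ℤ) % 3 = 2 := by exact_mod_cast hmod
  have hA0' : (1 : ℤ) ≤ A₀ := by zify at hA0; linarith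
  have hA3' : (1 : ℤ) ≤ A₃ := by zify at hA3; linarith
  rcases law_sub_one_classes N A₀ (X + Y + Z) (X' + Y' + Z') A₃ hNpos hmodz hN₁ hN₂ q₁ q₂ qA1 qA2 qsum eV with
    ⟨b1, b2⟩ | ⟨b1, b2, hc⟩ | ⟨b1, b2, hc⟩
  · exact ⟨hA0, hA3, by zify; linarith only [b1, hX, hY, hZ], by zify; linarith only [b2, hX', hY', hZ']⟩
  · exfalso
    rcases hc with ⟨g0, g3⟩ | ⟨g0, g3⟩
    · -- class (a): `q = A₀ - 1`
      refine no_root_class_a (x := X) (y := Y) (z := Z) (q := A₀ - 1) (by omega) (by linarith) ?_ ?_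
      · rw [← e₁, b2, show (N : ℤ) - 1 = 3 * (A₀ - 1) + 1 by linarith]; ring
      · rw [e₃]; have : A₃ = A₀ - 2 := by linarith
        rw [this]; ring
    · -- class (b): `q = A₀`
      refine no_root_class_b (x := X) (y := Y) (z := Z) (q := A₀) hA0' (by linarith) ?_ ?_
      · rw [← e₁, b2, show (N : ℤ) - 1 = 3 * A₀ + 1 by linarith]
      · rw [e₃]; have : A₃ = A₀ := by linarith
        rw [this]; ring
  · exfalso
    rcases hc with ⟨g3, g0⟩ | ⟨g3, g0⟩
    · refine no_root_class_a (x := X') (y := Y') (z := Z') (q := A₃ - 1) (by omega) (by linarith) ?_ ?_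
      · rw [← e₂, b1, show (N : ℤ) - 1 = 3 * (A₃ - 1) + 1 by linarith]; ring
      · rw [e₃']; have : A₀ = A₃ - 2 := by linarith
        rw [this]; ring
    · refine no_root_class_b (x := X') (y := Y') (z := Z') (q := A₃) hA3' (by linarith) ?_ ?_
      · rw [← e₂, b1, show (N : ℤ) - 1 = 3 * A₃ + 1 by linarith]; ring
      · rw [e₃']; have : A₀ = A₃ := by linarith
        rw [this]; ring

/-! ## Group level -/

section DihedralLike

variable {A : Type*} [AddCommGroup A] [DecidableEq A] [Fintype A] {G : Type} [Group G] [DecidableEq G]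
  {ρ τ : A → G} {c₀ : A} {S T U : Finset G}

/-- **No TPP triple has `3|S||T||U| + 7 = 8|A|`** (`|A| ≡ 2 (mod 3)`, even, `≥ 14`; any dihedral-like
presentation). [folklore] -/
theorem tpp_volume_ne_law_sub_one
    (hρρ : ∀ a b, ρ a * ρ b = ρ (a + b)) (hρτ : ∀ a b, ρ a * τ b = τ (b - a))
    (hτρ : ∀ a b, τ a * ρ b = τ (a + b)) (hττ : ∀ a b, τ a * τ b = ρ (c₀ + b - a))
    (hρ : Function.Injective ρ) (hτ : Function.Injective τ) (hne : ∀ a b, ρ a ≠ τ b)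
    (hsurj : ∀ g, (∃ a, ρ a = g) ∨ (∃ a, τ a = g)) (hmod : Fintype.card A % 3 = 2)
    (heven : Fintype.card A % 2 = 0) (hA : 14 ≤ Fintype.card A) (h : TripleProductProperty S T U) :
    3 * (S.card * T.card * U.card) + 7 ≠ 8 * Fintype.card A := by
  intro hV
  obtain ⟨h₀, h₃, h₁, h₂⟩ := parts_counting' hρρ hρτ hτρ hττ hρ hτ hne h
  rw [card_eq_parts' hρ hτ hne hsurj S, card_eq_parts' hρ hτ hne hsurj T, card_eq_parts' hρ hτ hne hsurj U] at hV
  obtain ⟨hA0, hA3, hB1, hB2⟩ := parts_no_law_sub_one (Fintype.card A) _ _ _ _ _ _ hmod heven hA h₀ h₃ h₁ h₂ hV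
  have pos : ∀ {a b c : Finset A}, 1 ≤ a.card * b.card * c.card → a.Nonempty ∧ b.Nonempty ∧ c.Nonempty := by
    intro a b c habc
    refine ⟨card_pos.1 (Nat.pos_of_ne_zero fun h0 => ?_), card_pos.1 (Nat.pos_of_ne_zero fun h0 => ?_),
      card_pos.1 (Nat.pos_of_ne_zero fun h0 => ?_)⟩ <;> simp [h0] at habc
  obtain ⟨neS₀, neT₀, neU₀⟩ := pos hA0
  obtain ⟨neS₁, neT₁, neU₁⟩ := pos hA3
  have h3 := three_dvd_of_double_tiling' hρρ hρτ hτρ hττ hρ hτ hne h neS₀ neS₁ neT₀ neT₁ neU₀ neU₁ hB1 hB2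
  omega

/-- **Over a non-cyclic `A` the law is missed by at least two**: `3|S||T||U| + 10 ≤ 8|A|`
(`|S||T||U| ≤ 4⌊2|A|/3⌋ − 2`). [folklore] -/
theorem tpp_volume_le_law_sub_two_of_not_cyclic [Fintype G]
    (hρρ : ∀ a b, ρ a * ρ b = ρ (a + b)) (hρτ : ∀ a b, ρ a * τ b = τ (b - a))
    (hτρ : ∀ a b, τ a * ρ b = τ (a + b)) (hττ : ∀ a b, τ a * τ b = ρ (c₀ + b - a))
    (hρ : Function.Injective ρ) (hτ : Function.Injective τ) (hne : ∀ a b, ρ a ≠ τ b)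
    (hsurj : ∀ g, (∃ a, ρ a = g) ∨ (∃ a, τ a = g)) (hmod : Fintype.card A % 3 = 2)
    (heven : Fintype.card A % 2 = 0) (hA : 14 ≤ Fintype.card A)
    (hnc : ¬ ∃ g : A, ∀ x : A, x ∈ AddSubgroup.zmultiples g) (h : TripleProductProperty S T U) :
    3 * (S.card * T.card * U.card) + 10 ≤ 8 * Fintype.card A := by
  have h7 := tpp_volume_lt_law_of_not_cyclic hρρ hρτ hτρ hττ hρ hτ hne hsurj hmod heven hA hnc h
  have hne7 := tpp_volume_ne_law_sub_one hρρ hρτ hτρ hττ hρ hτ hne hsurj hmod heven hA h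
  omega

end DihedralLike

/-- **`C₂ × D_{2k}`, `k` even, `k ≡ 1 (mod 3)`, `k ≥ 7`: `3|S||T||U| + 10 ≤ 16k`**, i.e. with
`C2DihedralLowerBound.lean` the kernel window is `8⌊2k/3⌋ ≤ β(C₂ × D_{2k}) ≤ 8⌊2k/3⌋ + 2`. [folklore] -/
theorem tpp_volume_le_law_sub_two_c2_dihedral {k : ℕ} [NeZero k] (hk2 : 2 ∣ k) (hk3 : k % 3 = 1) (hk7 : 7 ≤ k)
    {S T U : Finset (Multiplicative (ZMod 2) × DihedralGroup k)} (h : TripleProductProperty S T U) :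
    3 * (S.card * T.card * U.card) + 10 ≤ 16 * k := by
  have key := tpp_volume_le_law_sub_two_of_not_cyclic (A := ZMod 2 × ZMod k)
    (ρ := fun p : ZMod 2 × ZMod k => (Multiplicative.ofAdd p.1, DihedralGroup.r p.2))
    (τ := fun p : ZMod 2 × ZMod k => (Multiplicative.ofAdd p.1, DihedralGroup.sr p.2)) (c₀ := (0 : ZMod 2 × ZMod k))
    (fun a b => by
      simp only [Prod.mk_mul_mk, DihedralGroup.r_mul_r, ← ofAdd_add, Prod.fst_add, Prod.snd_add])
    (fun a b => by
      simp only [Prod.mk_mul_mk, DihedralGroup.r_mul_sr, ← ofAdd_add, Prod.fst_sub, Prod.snd_sub]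
      rw [sub_eq_add_neg b.1, ZMod.neg_eq_self_mod_two, add_comm b.1])
    (fun a b => by
      simp only [Prod.mk_mul_mk, DihedralGroup.sr_mul_r, ← ofAdd_add, Prod.fst_add, Prod.snd_add])
    (fun a b => by
      simp only [Prod.mk_mul_mk, DihedralGroup.sr_mul_sr, ← ofAdd_add, zero_add, Prod.fst_sub, Prod.snd_sub]
      rw [sub_eq_add_neg b.1, ZMod.neg_eq_self_mod_two, add_comm b.1])
    (fun a b hab => by
      simp only [Prod.mk.injEq, DihedralGroup.r.injEq] at hab
      exact Prod.ext (Multiplicative.ofAdd.injective hab.1) hab.2)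
    (fun a b hab => by
      simp only [Prod.mk.injEq, DihedralGroup.sr.injEq] at hab
      exact Prod.ext (Multiplicative.ofAdd.injective hab.1) hab.2)
    (fun a b hab => by simp at hab)
    (fun g => by
      obtain ⟨m, d⟩ := g
      cases d with
      | r i => exact Or.inl ⟨(Multiplicative.toAdd m, i), rfl⟩
      | sr i => exact Or.inr ⟨(Multiplicative.toAdd m, i), rfl⟩)
    (by rw [Fintype.card_prod, ZMod.card, ZMod.card]; omega)
    (by rw [Fintype.card_prod, ZMod.card, ZMod.card]; omega)
    (by rw [Fintype.card_prod, ZMod.card, ZMod.card]; omega)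
    (not_cyclic_zmod_two_prod hk2) h
  rw [Fintype.card_prod, ZMod.card, ZMod.card] at key
  omega

end Summit.MatrixMultiplication.OmegaCensus
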